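import Summits.Ventures.HodgeRepro2.T5SU11ResolventL1Bound

/-!
# The resolvent on `L¹(sinh 2t dt)` for `λ > 2`: every integrable source of the class

Row 544 proved `∫ |G^I_λ g| sinh 2t ≤ (∫ |g| sinh 2s)/μ` for sources of the class at a rate `ε > 2` — the rate was
used only to make the product integrand `|K_λ(t, s)| |g(s)| sinh 2s · sinh 2t` integrable on `(0, ∞)²` through row 520.
Here the rate restriction is removed: for `λ > 2` (`μ = λ(λ − 2) > 0`), a source `g` of the class (rate `ε > 2 − λ`,
which only guarantees that `G^I_λ g` is defined) with **`|g| sinh 2s ∈ L¹(0, ∞)`** has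

* `integrable_prod_kernel_abs` — the product integrand is integrable on `(0, ∞)²` (`integrable_prod_iff'`: the columns
  `t ↦ |K_λ(t, s)| sinh 2t` are integrable with integral `1/μ` — rows 542/543 through the symmetry of the kernel — and
  the outer function `s ↦ |g(s)| sinh 2s/μ` is integrable by hypothesis);
* `integrableOn_greenSolI_mul_sinh` — **`G^I_λ g · sinh 2t` is integrable on `(0, ∞)`**: the resolvent maps
  `L¹(sinh 2t dt) ∩ class` into `L¹(sinh 2t dt)`;
* `integral_abs_greenSolI_mul_sinh_le_of_integrable` — **`∫ |G^I_λ g| sinh 2t ≤ (∫ |g| sinh 2s)/μ`** — the sharp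
  `L¹` bound with the constant `1/μ = 1/dist(μ, 0)` of rows 542–544, now for every integrable source of the class.

Nothing is claimed about (N).

Blind lane: Mathlib + the HodgeRepro2 prefix only; no sorry; axioms ⊆ {propext, Classical.choice,
Quot.sound}.
-/

namespace Summit.Ventures.HodgeRepro2.T5SU11ResolventL1Class

open Filter Topology MeasureTheory
open Set (Ioi Ioc)
open T5SU11Cartan T5SU11SphericalFunction T5SU11SphericalDecay T5SU11RadialGreenKernel
  T5SU11RadialGreenImproper T5SU11RadialGreenImproperDecaySource T5SU11RadialGreenImproperStable
  T5SU11ResolventKernelComposition T5SU11ResolventTransformClass T5SU11ResolventSupNorm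
  T5SU11ResolventConstantSource T5SU11RadialGreenPositivity T5SU11SphericalContinuous

section measure

variable [MeasurableSpace Circle] [BorelSpace Circle]

/-- **The columns of the kernel are integrable**: for `λ > 2` and `s > 0`, `t ↦ |K_λ(t, s)| sinh 2t` is integrable on
`(0, ∞)` (the column is the row at `s` of the symmetric kernel, against the constant source). -/
theorem integrableOn_abs_sphGreenKernel_mul_sinh_fst {lam : ℝ} (h2 : 2 < lam) {s : ℝ} (hs : 0 < s) :
    IntegrableOn (fun t => |sphGreenKernel lam t s| * Real.sinh (2 * t)) (Ioi 0) := by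
  have hlam : 1 < lam := by linarith
  have hI := integrableOn_kernel_mul (φ := fun t => sph lam (hyp t)) (χ := sphDecay lam) (g := fun _ => (1 : ℝ))
    (fun T => integrableOn_sph_mul_one_mul_sinh lam T) (integrableOn_sphDecay_mul_one_mul_sinh h2) hs
  refine hI.neg.congr_fun (fun t ht => ?_) measurableSet_Ioi
  have ht0 : 0 < t := ht
  simp only [Pi.neg_apply]
  rw [sphGreenKernel_symm lam t s, abs_of_neg (sphGreenKernel_neg hlam hs)]
  unfold sphGreenKernel
  ring

/-- **The column sums of the kernel**: `∫_{(0,∞)} |K_λ(t, s)| sinh 2t dt = 1/μ` for every `s > 0`, `λ > 2` (row 543's row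
sums through the symmetry of the kernel). -/
theorem integral_abs_sphGreenKernel_mul_sinh_fst {lam : ℝ} (h2 : 2 < lam) {s : ℝ} (hs : 0 < s) :
    ∫ t in Ioi 0, |sphGreenKernel lam t s| * Real.sinh (2 * t) = 1 / (lam * (lam - 2)) := by
  rw [← integral_abs_sphGreenKernel_mul_sinh h2 hs]
  apply setIntegral_congr_fun measurableSet_Ioi
  intro t _
  simp only
  rw [sphGreenKernel_symm lam t s]

variable {lam : ℝ} (h2 : 2 < lam) {g : ℝ → ℝ} (hg : ContinuousOn g (Ioi 0))
  {M : ℝ} (hM : ∀ s ∈ Ioc (0 : ℝ) 1, |g s| ≤ M) (hM0 : 0 ≤ M)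
  {ε C s₀ : ℝ} (hε : 2 - lam < ε) (hC : ∀ s, s₀ ≤ s → |g s| ≤ C * Real.exp (-ε * s))
  (hg1 : IntegrableOn (fun s => |g s| * Real.sinh (2 * s)) (Ioi 0))

include h2 hg hg1 in
/-- **The product integrand `|K_λ(t, s)| |g(s)| sinh 2s · sinh 2t` is integrable on `(0, ∞)²`** for `λ > 2` and every
continuous source with `|g| sinh 2s ∈ L¹(0, ∞)`. -/
theorem integrable_prod_kernel_abs :
    Integrable (Function.uncurry fun t s => |sphGreenKernel lam t s| * (|g s| * Real.sinh (2 * s)) * Real.sinh (2 * t))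
      ((volume.restrict (Ioi 0)).prod (volume.restrict (Ioi 0))) := by
  have hlam : 1 < lam := by linarith
  have hμ : 0 < lam * (lam - 2) := mul_pos (by linarith) (by linarith)
  have hχ : ContinuousOn (sphDecay lam) (Ioi 0) :=
    fun _ hr => (hasDerivAt_sphDecay hlam hr).continuousAt.continuousWithinAt
  -- measurability: the integrand is continuous on the open quadrant
  have hmeas : AEStronglyMeasurable (Function.uncurry fun t s => |sphGreenKernel lam t s|
      * (|g s| * Real.sinh (2 * s)) * Real.sinh (2 * t)) ((volume.restrict (Ioi 0)).prod (volume.restrict (Ioi 0))) := by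
    rw [Measure.prod_restrict]
    refine ContinuousOn.aestronglyMeasurable ?_ (measurableSet_Ioi.prod measurableSet_Ioi)
    have hK : ContinuousOn (fun p : ℝ × ℝ => sphGreenKernel lam p.1 p.2) (Ioi 0 ×ˢ Ioi 0) := by
      simp only [sphGreenKernel, greenKernel]
      apply ContinuousOn.neg
      apply ContinuousOn.mul
      · exact ((continuous_sph_hyp lam).comp (continuous_fst.min continuous_snd)).continuousOn
      · exact hχ.comp (continuous_fst.max continuous_snd).continuousOn
          (fun p hp => Set.mem_Ioi.mpr (lt_of_lt_of_le (Set.mem_Ioi.mp hp.1) (le_max_left _ _)))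
    have hg' : ContinuousOn (fun p : ℝ × ℝ => g p.2) (Ioi 0 ×ˢ Ioi 0) :=
      hg.comp continuous_snd.continuousOn (fun p hp => hp.2)
    exact ((hK.abs.mul (hg'.abs.mul
      (Real.continuous_sinh.comp (continuous_const.mul continuous_snd)).continuousOn))).mul
      (Real.continuous_sinh.comp (continuous_const.mul continuous_fst)).continuousOn
  rw [integrable_prod_iff' hmeas]
  refine ⟨?_, ?_⟩
  · -- for every `s > 0`, the column `t ↦ |K_λ(t, s)| sinh 2t · |g s| sinh 2s` is integrable
    refine (ae_restrict_iff' measurableSet_Ioi).mpr (Eventually.of_forall fun s hs => ?_)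
    have hs0 : 0 < s := hs
    have h := (integrableOn_abs_sphGreenKernel_mul_sinh_fst h2 hs0).mul_const (|g s| * Real.sinh (2 * s))
    refine h.congr (Eventually.of_forall fun t => ?_)
    simp only [Function.uncurry_apply_pair]
    ring
  · -- the outer function `s ↦ ∫_t ‖F(t, s)‖ dt = |g s| sinh 2s/μ` is integrable
    have hI := hg1.mul_const (1 / (lam * (lam - 2)))
    refine hI.congr ?_
    refine (ae_restrict_iff' measurableSet_Ioi).mpr (Eventually.of_forall fun s hs => ?_)
    have hs0 : 0 < s := hs
    have hsinh : 0 ≤ Real.sinh (2 * s) := Real.sinh_nonneg_iff.mpr (by linarith)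
    have e : ∀ t, ‖Function.uncurry (fun t s => |sphGreenKernel lam t s| * (|g s| * Real.sinh (2 * s))
        * Real.sinh (2 * t)) (t, s)‖
        = |(|sphGreenKernel lam t s| * Real.sinh (2 * t))| * (|g s| * Real.sinh (2 * s)) := by
      intro t
      simp only [Function.uncurry_apply_pair, Real.norm_eq_abs]
      rw [show |sphGreenKernel lam t s| * (|g s| * Real.sinh (2 * s)) * Real.sinh (2 * t)
        = (|sphGreenKernel lam t s| * Real.sinh (2 * t)) * (|g s| * Real.sinh (2 * s)) by ring,
        abs_mul, abs_of_nonneg (mul_nonneg (abs_nonneg _) hsinh)]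
    simp only [e]
    rw [MeasureTheory.integral_mul_const]
    have hcol : ∫ t in Ioi 0, |(|sphGreenKernel lam t s| * Real.sinh (2 * t))| = 1 / (lam * (lam - 2)) := by
      rw [← integral_abs_sphGreenKernel_mul_sinh_fst h2 hs0]
      apply setIntegral_congr_fun measurableSet_Ioi
      intro t ht
      have ht0 : 0 < t := ht
      simp only
      rw [abs_of_nonneg (mul_nonneg (abs_nonneg _) (Real.sinh_nonneg_iff.mpr (by linarith)))]
    rw [hcol]
    ring

include h2 hg hM hM0 hε hC in
/-- The pointwise bound `|G^I_λ g(t)| sinh 2t ≤ ∫_{(0,∞)} |K_λ(t, s)| |g(s)| sinh 2s · sinh 2t ds` for every `t > 0`. -/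
theorem abs_greenSolI_mul_sinh_le_integral {t : ℝ} (ht : 0 < t) :
    |greenSolI (fun t => sph lam (hyp t)) (sphDecay lam) g t| * Real.sinh (2 * t)
      ≤ ∫ s in Ioi 0, |sphGreenKernel lam t s| * (|g s| * Real.sinh (2 * s)) * Real.sinh (2 * t) := by
  have hlam : 1 < lam := by linarith
  have hB := integrableOn_sph_mul_mul_sinh_Ioc hg hM hM0 lam
  have hA := integrableOn_sphDecay_mul_mul_sinh hlam hg hM hM0 hε hC
  have hsinh : 0 ≤ Real.sinh (2 * t) := Real.sinh_nonneg_iff.mpr (by linarith)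
  have hrep := greenSolI_eq_integral_kernel hB hA ht
  calc |greenSolI (fun t => sph lam (hyp t)) (sphDecay lam) g t| * Real.sinh (2 * t)
      = |∫ s in Ioi 0, greenKernel (fun t => sph lam (hyp t)) (sphDecay lam) t s * g s * Real.sinh (2 * s)|
        * Real.sinh (2 * t) := by rw [hrep]
    _ ≤ (∫ s in Ioi 0, |greenKernel (fun t => sph lam (hyp t)) (sphDecay lam) t s * g s * Real.sinh (2 * s)|)
        * Real.sinh (2 * t) := by
        apply mul_le_mul_of_nonneg_right _ hsinh
        have := norm_integral_le_integral_norm (μ := volume.restrict (Ioi 0))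
          (fun s => greenKernel (fun t => sph lam (hyp t)) (sphDecay lam) t s * g s * Real.sinh (2 * s))
        simpa only [Real.norm_eq_abs] using this
    _ = ∫ s in Ioi 0, |sphGreenKernel lam t s| * (|g s| * Real.sinh (2 * s)) * Real.sinh (2 * t) := by
        rw [← MeasureTheory.integral_mul_const]
        apply setIntegral_congr_fun measurableSet_Ioi
        intro s hs
        have hs0 : 0 < s := hs
        simp only [sphGreenKernel]
        rw [abs_mul, abs_mul, abs_of_nonneg (Real.sinh_nonneg_iff.mpr (by linarith : (0 : ℝ) ≤ 2 * s))]
        ring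

include h2 hg hM hM0 hε hC hg1 in
/-- **THE RESOLVENT PRESERVES `L¹(sinh 2t dt)`**: for `λ > 2` and a source `g` of the class with `|g| sinh 2s ∈ L¹(0, ∞)`,
`G^I_λ g · sinh 2t` is integrable on `(0, ∞)`. -/
theorem integrableOn_greenSolI_mul_sinh :
    IntegrableOn (fun t => greenSolI (fun t => sph lam (hyp t)) (sphDecay lam) g t * Real.sinh (2 * t)) (Ioi 0) := by
  have hlam : 1 < lam := by linarith
  have hF := integrable_prod_kernel_abs h2 hg hg1
  have hH := hF.integral_prod_left
  have hcont : ContinuousOn (fun t => greenSolI (fun t => sph lam (hyp t)) (sphDecay lam) g t * Real.sinh (2 * t))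
      (Ioi 0) :=
    (continuousOn_greenSolI hlam hg hM hM0 hε hC).mul
      (Real.continuous_sinh.comp (continuous_const.mul continuous_id)).continuousOn
  refine Integrable.mono' hH (hcont.aestronglyMeasurable measurableSet_Ioi) ?_
  refine (ae_restrict_iff' measurableSet_Ioi).mpr (Eventually.of_forall fun t ht => ?_)
  have ht0 : 0 < t := ht
  have hsinh : 0 ≤ Real.sinh (2 * t) := Real.sinh_nonneg_iff.mpr (by linarith)
  rw [Real.norm_eq_abs, abs_mul, abs_of_nonneg hsinh]
  simpa only [Function.uncurry_apply_pair] using abs_greenSolI_mul_sinh_le_integral h2 hg hM hM0 hε hC ht0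

include h2 hg hM hM0 hε hC hg1 in
/-- **THE `L¹` BOUND OF THE RESOLVENT FOR EVERY INTEGRABLE SOURCE OF THE CLASS**:
`∫_{(0,∞)} |G^I_λ g| sinh 2t dt ≤ (∫_{(0,∞)} |g| sinh 2s ds)/μ` for `λ > 2` — the operator norm of `(L − μ)⁻¹` on
`L¹(sinh 2t dt)` is at most `1/μ` (and `1/μ` is attained on the constant source in the sup-norm, row 542). -/
theorem integral_abs_greenSolI_mul_sinh_le_of_integrable :
    ∫ t in Ioi 0, |greenSolI (fun t => sph lam (hyp t)) (sphDecay lam) g t| * Real.sinh (2 * t)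
      ≤ (∫ s in Ioi 0, |g s| * Real.sinh (2 * s)) / (lam * (lam - 2)) := by
  have hμ : 0 < lam * (lam - 2) := mul_pos (by linarith) (by linarith)
  have hF := integrable_prod_kernel_abs h2 hg hg1
  have hswap := integral_integral_swap hF
  -- the left-hand side is dominated by the iterated integral
  have hleft : ∫ t in Ioi 0, |greenSolI (fun t => sph lam (hyp t)) (sphDecay lam) g t| * Real.sinh (2 * t)
      ≤ ∫ t in Ioi 0, ∫ s in Ioi 0, |sphGreenKernel lam t s| * (|g s| * Real.sinh (2 * s)) * Real.sinh (2 * t) := by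
    refine integral_mono_of_nonneg ?_ hF.integral_prod_left ?_
    · exact ae_restrict_of_forall_mem measurableSet_Ioi (fun t ht =>
        mul_nonneg (abs_nonneg _) (Real.sinh_nonneg_iff.mpr (by linarith [Set.mem_Ioi.mp ht])))
    · exact ae_restrict_of_forall_mem measurableSet_Ioi
        (fun t ht => abs_greenSolI_mul_sinh_le_integral h2 hg hM hM0 hε hC ht)
  -- the swapped iterated integral is `∫_s |g s| sinh 2s/μ`
  have hright : ∫ s in Ioi 0, ∫ t in Ioi 0, |sphGreenKernel lam t s| * (|g s| * Real.sinh (2 * s)) * Real.sinh (2 * t)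
      = (∫ s in Ioi 0, |g s| * Real.sinh (2 * s)) / (lam * (lam - 2)) := by
    rw [← MeasureTheory.integral_div]
    apply setIntegral_congr_fun measurableSet_Ioi
    intro s hs
    have hs0 : 0 < s := hs
    simp only
    have e : ∀ t, |sphGreenKernel lam t s| * (|g s| * Real.sinh (2 * s)) * Real.sinh (2 * t)
        = |sphGreenKernel lam t s| * Real.sinh (2 * t) * (|g s| * Real.sinh (2 * s)) := fun t => by ring
    simp only [e]
    rw [MeasureTheory.integral_mul_const, integral_abs_sphGreenKernel_mul_sinh_fst h2 hs0]
    ring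
  calc ∫ t in Ioi 0, |greenSolI (fun t => sph lam (hyp t)) (sphDecay lam) g t| * Real.sinh (2 * t)
      ≤ ∫ t in Ioi 0, ∫ s in Ioi 0, |sphGreenKernel lam t s| * (|g s| * Real.sinh (2 * s)) * Real.sinh (2 * t) := hleft
    _ = ∫ s in Ioi 0, ∫ t in Ioi 0, |sphGreenKernel lam t s| * (|g s| * Real.sinh (2 * s)) * Real.sinh (2 * t) := hswap
    _ = (∫ s in Ioi 0, |g s| * Real.sinh (2 * s)) / (lam * (lam - 2)) := hright

end measure

end Summit.Ventures.HodgeRepro2.T5SU11ResolventL1Class
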